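/-
Copyright (c) 2026. All rights reserved.
Released under Apache 2.0 license as described in the file LICENSE.
Authors: abc-iut cell, statement-typer seat abc-iut-L4-t3 (wave 1).
-/
import Literature.AnabelianGeometry.AbsoluteAnabelian.LogFrobeniusPanalocalizationTelecoreProofs
import HarnessLib

/-!
# [AbsTopIII] Corollary 5.5 (vi), telecore clause: the IDENTITY panalocalization of any setting lies over `𝒳`, hence
# satisfies the clause (non-vacuity of the coherence datum `TelecoreOverHom`)

S. Mochizuki, *Topics in absolute anabelian geometry III: global reconstruction algorithms*,
J. Math. Sci. Univ. Tokyo 22 (2015) 939–1156 [MochizukiAbsTopIII2015]; Cor 5.5 (vi) p. 132, Def 5.1 (vi) p. 118.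

Companion of `LogFrobeniusPanalocalizationTelecoreProofs.lean` (this seat: the telecore clause of Cor 5.5 (vi) PROVED
for every panalocalization equipped with the coherence datum `Panalocalization.TelecoreOverHom`).  Here the datum is
shown to be INHABITED in the simplest case, uniformly in the setting: the identity panalocalization `D• → D•` of ANY
log-Frobenius setting `L` (`Panalocalization.identity L`: every vertex functor `𝟭`, every 2-cell the unitor composite
`𝟭 ⋙ F ≅ F ≅ F ⋙ 𝟭` — the named form of abc-iut-w4-d095's anonymous witness `Panalocalization.exists_self_panT_eq_id`)
lies over `𝒳` with `θ_v` the unitors (`identityTelecoreOverHom`), so that `Cor55PanalocalizationTelecore (identity L)`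
HOLDS for every `L` with `V(F_mod) ≠ ∅` (`cor55PanalocalizationTelecore_identity`).  HONEST LABEL: a consistency witness
for the typed clause at `L₁ = L₂` (print's morphism goes `D⊚ → D✠` between two different settings); no arithmetic
content.  Refereed pre-IUT material; nothing here bears on [IUTchIII] Cor. 3.12; typed ≠ proved.
-/

set_option autoImplicit false

noncomputable section

universe u

open CategoryTheory Quiver

namespace Literature.AnabelianGeometry.AbsoluteAnabelian

namespace Panalocalization

open DiagramOfCategories LogFrobeniusSetting

variable {Vmod : Type u} {isArc : Vmod → Bool} (L : LogFrobeniusSetting Vmod isArc)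

/-- **the identity panalocalization `D• → D•` of a setting** (named form of abc-iut-w4-d095's witness): all vertex functors
`𝟭`, all 2-cells unitor composites. [cite: MochizukiAbsTopIII2015, Cor 5.5 (vi) p. 132] -/
def identity : Panalocalization L L where
  panT := 𝟭 _
  pan := 𝟭 _
  over := L.proj.leftUnitor ≪≫ L.proj.rightUnitor.symm
  panNplus := fun _ => 𝟭 _
  panN := fun _ => 𝟭 _
  panAn := 𝟭 _
  panNmonoPlus := fun _ => 𝟭 _
  panNmono := fun _ => 𝟭 _
  panEmono := 𝟭 _
  panAnMono := 𝟭 _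
  isoLog := L.log.leftUnitor ≪≫ L.log.rightUnitor.symm
  isoLam := fun v ν => (L.lam v ν).leftUnitor ≪≫ (L.lam v ν).rightUnitor.symm
  isoForget := fun v => (L.forget v).leftUnitor ≪≫ (L.forget v).rightUnitor.symm
  isoToE := fun v => (L.toE v).leftUnitor ≪≫ (L.toE v).rightUnitor.symm
  isoκAn := L.κAn.functor.leftUnitor ≪≫ L.κAn.functor.rightUnitor.symm
  isoAnToE := L.κAn₂.functor.leftUnitor ≪≫ L.κAn₂.functor.rightUnitor.symm
  isoMonoNplus := fun v => (L.monoNplus v).leftUnitor ≪≫ (L.monoNplus v).rightUnitor.symm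
  isoMonoN := fun v => (L.monoN v).leftUnitor ≪≫ (L.monoN v).rightUnitor.symm
  isoMonoE := L.monoAn.leftUnitor ≪≫ L.monoAn.rightUnitor.symm
  isoMonoAn := (L.κAn.inverse ⋙ L.monoAn ⋙ L.κAnMono.functor).leftUnitor ≪≫
    (L.κAn.inverse ⋙ L.monoAn ⋙ L.κAnMono.functor).rightUnitor.symm
  isoForgetMono := fun w => (L.forgetMono w).leftUnitor ≪≫ (L.forgetMono w).rightUnitor.symm
  isoToEmono := fun w => (L.toEmono w).leftUnitor ≪≫ (L.toEmono w).rightUnitor.symm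
  isoκAnMono := L.κAnMono.functor.leftUnitor ≪≫ L.κAnMono.functor.rightUnitor.symm
  isoAnMonoToE := L.κAnMono.inverse.leftUnitor ≪≫ L.κAnMono.inverse.rightUnitor.symm
  isoφAn := L.φAn.leftUnitor ≪≫ L.φAn.rightUnitor.symm
  panNmonoPlus_isEquivalence := fun _ => inferInstance
  panNmono_isEquivalence := fun _ => inferInstance
  panEmono_isEquivalence := inferInstance
  panAnMono_isEquivalence := inferInstance

/-- the functor of the identity panalocalization at `𝒳` is the identity. [cite: MochizukiAbsTopIII2015, Cor 5.5 (vi) p. 132] -/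
@[simp] theorem identity_panT : (identity L).panT = 𝟭 L.X := rfl

/-- a functor respects heterogeneous equality of morphisms between equal objects. [folklore] -/
private theorem map_heq {A B : Type (u + 1)} [Category.{u} A] [Category.{u} B] (G : A ⥤ B) {X Y X' Y' : A}
    (hX : X = X') (hY : Y = Y') {f : X ⟶ Y} {f' : X' ⟶ Y'} (h : HEq f f') : HEq (G.map f) (G.map f') := by
  subst hX hY; cases h; rfl

/-- components of a natural transformation at equal objects are heterogeneously equal. [folklore] -/
private theorem app_heq {A B : Type (u + 1)} [Category.{u} A] [Category.{u} B] {G H : A ⥤ B} (α : G ⟶ H) {x x' : A}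
    (h : x = x') : HEq (α.app x) (α.app x') := by
  subst h; rfl

/-- the vertex functors of `Ψ` for the identity panalocalization act as the identity on objects.
[cite: MochizukiAbsTopIII2015, Cor 5.5 (vi) p. 132] -/
theorem identity_telecoreApp_obj (w : (anTelecoreShape (Vmod := Vmod) (isArc := isArc) anTelJ).Vertex)
    (y : (L.anTelecoreDiagram anTelJ (fun {a} j => L.telecoreFun a.1 j)).obj w) :
    ((identity L).telecoreHom.app w).obj y = y := by
  rcases w with ⟨a, ha⟩ | _
  · change ((identity L).app a).obj y = y
    cases a <;> rfl
  · rfl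

/-- the vertex functors of `Ψ` for the identity panalocalization ARE identity functors.
[cite: MochizukiAbsTopIII2015, Cor 5.5 (vi) p. 132] -/
theorem identity_telecoreApp_eq (w : (anTelecoreShape (Vmod := Vmod) (isArc := isArc) anTelJ).Vertex) :
    (identity L).telecoreHom.app w = 𝟭 _ := by
  rcases w with ⟨a, ha⟩ | _
  · change (identity L).app a = 𝟭 _
    cases a <;> rfl
  · rfl

/-- an `eqToHom` is heterogeneously an identity. [folklore] -/
private theorem heq_id_of_eq {C₀ : Type (u + 1)} [Category.{u} C₀] {X Y Z : C₀} (h : X = Y) (hX : X = Z) :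
    HEq (eqToHom h) (𝟙 Z) := by
  subst hX; subst h; rfl

/-- the components of a unitor composite `𝟭 ⋙ F ≅ F ≅ F ⋙ 𝟭` are identities, heterogeneously. [folklore] -/
private theorem unitors_hom_app_heq {A B : Type (u + 1)} [Category.{u} A] [Category.{u} B] (G : A ⥤ B) (y : A) :
    HEq ((G.leftUnitor ≪≫ G.rightUnitor.symm).hom.app y) (𝟙 (G.obj y)) := by
  simp only [Iso.trans_hom, Iso.symm_hom, NatTrans.comp_app, Functor.leftUnitor_hom_app, Functor.rightUnitor_inv_app]
  exact heq_of_eq (Category.id_comp _)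

/-- the 2-cells of the induced 1-morphism `Ψ` of the telecore diagrams for the identity panalocalization are identities
(componentwise, heterogeneously). [cite: MochizukiAbsTopIII2015, Cor 5.5 (vi) p. 132] -/
theorem identity_telecoreIso_hom_app_heq :
    ∀ {w w' : (anTelecoreShape (Vmod := Vmod) (isArc := isArc) anTelJ).Vertex} (e : w ⟶ w')
      (y : (L.anTelecoreDiagram anTelJ (fun {a} j => L.telecoreFun a.1 j)).obj w),
      HEq (((identity L).telecoreHom.iso e).hom.app y)
        (𝟙 (((L.anTelecoreDiagram anTelJ (fun {a} j => L.telecoreFun a.1 j)).map e).obj y)) := by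
  rintro (a | _) (b | _) e y
  · obtain ⟨a, ha⟩ := a
    obtain ⟨b, hb⟩ := b
    change HEq (((identity L).iso e).hom.app y) _
    cases e <;> exact unitors_hom_app_heq _ _
  · obtain ⟨a, ha⟩ := a
    change HEq (((identity L).telecoreIsoObs ⟨a, ha⟩ e).hom.app y) _
    cases e
    exact unitors_hom_app_heq _ _
  · obtain ⟨b, hb⟩ := b
    change HEq (((identity L).telecoreIsoTel ⟨b, hb⟩ e).hom.app y) _
    cases b <;> first | exact (PEmpty.elim e) | exact unitors_hom_app_heq _ _
  · exact PEmpty.elim e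

/-- abstract bookkeeping: `𝟙 ≫ 𝟙 ≫ m = m`. [folklore] -/
private theorem id_id_comp {C₀ : Type (u + 1)} [Category.{u} C₀] {X Y : C₀} (m : X ⟶ Y) : 𝟙 X ≫ 𝟙 X ≫ m = m := by
  simp

/-- `θ_v` for the identity panalocalization: `Ψ_v ⋙ N_v = 𝟭 ⋙ N_v = N_v ⋙ 𝟭` (an `eqToIso`).
[cite: MochizukiAbsTopIII2015, Def 5.1 (vi) p. 118] -/
def identityθ (w : (anTelecoreShape (Vmod := Vmod) (isArc := isArc) anTelJ).Vertex) :
    (identity L).telecoreHom.app w ⋙ (L.contactOver).N w ≅ (L.contactOver).N w ⋙ 𝟭 L.X :=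
  eqToIso (by rw [identity_telecoreApp_eq]; rfl)

/-- its components are identities, heterogeneously. [folklore] -/
private theorem identityθ_hom_app_heq (w : (anTelecoreShape (Vmod := Vmod) (isArc := isArc) anTelJ).Vertex)
    (z : (L.anTelecoreDiagram anTelJ (fun {a} j => L.telecoreFun a.1 j)).obj w) :
    HEq ((identityθ L w).hom.app z) (𝟙 (((L.contactOver).N w).obj z)) := by
  simp only [identityθ, eqToIso.hom, eqToHom_app]
  exact heq_id_of_eq _ (by rw [identity_telecoreApp_eq]; rfl)

/-- **the identity panalocalization lies over `𝒳`**: `θ_v` the identification `𝟭 ⋙ N_v = N_v ⋙ 𝟭`, every prism commuting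
because every 2-cell involved is an identity. [cite: MochizukiAbsTopIII2015, Def 5.1 (vi) p. 118] -/
def identityTelecoreOverHom : (identity L).TelecoreOverHom where
  θ w := identityθ L w
  prism {w w'} e y := by
    refine heq_iff_eq.mp ?_
    have hΨ := identity_telecoreApp_eq L w
    have hΨ' := identity_telecoreApp_eq L w'
    -- LHS ≍ `μ_e y`
    have h₁ : HEq (((L.contactOver).N w').map (((identity L).telecoreHom.iso e).hom.app y))
        (𝟙 (((L.contactOver).N w').obj
          (((L.anTelecoreDiagram anTelJ (fun {a} j => L.telecoreFun a.1 j)).map e).obj y))) :=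
      (map_heq ((L.contactOver).N w') (by rw [hΨ]; rfl) (by rw [hΨ']; rfl) (identity_telecoreIso_hom_app_heq L e y)).trans
        (heq_of_eq (((L.contactOver).N w').map_id _))
    have h₂ := identityθ_hom_app_heq L w'
      (((L.anTelecoreDiagram anTelJ (fun {a} j => L.telecoreFun a.1 j)).map e).obj y)
    have h₃ : HEq ((𝟭 L.X).map (((L.contactOver).μ e).hom.app y)) (((L.contactOver).μ e).hom.app y) :=
      heq_of_eq (Functor.id_map _)
    have hL : HEq (((L.contactOver).N w').map (((identity L).telecoreHom.iso e).hom.app y) ≫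
        (identityθ L w').hom.app (((L.anTelecoreDiagram anTelJ (fun {a} j => L.telecoreFun a.1 j)).map e).obj y) ≫
        (𝟭 L.X).map (((L.contactOver).μ e).hom.app y)) (((L.contactOver).μ e).hom.app y) :=
      (heq_comp (by rw [hΨ]; rfl) (by rw [hΨ']; rfl) rfl h₁ (heq_comp (by rw [hΨ']; rfl) rfl rfl h₂ h₃)).trans
        (heq_of_eq (id_id_comp _))
    -- RHS ≍ `μ_e y`
    have h₄ : HEq (((L.contactOver).μ e).hom.app (((identity L).telecoreHom.app w).obj y))
        (((L.contactOver).μ e).hom.app y) := app_heq _ (identity_telecoreApp_obj L w y)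
    have h₅ := identityθ_hom_app_heq L w y
    have hR : HEq (((L.contactOver).μ e).hom.app (((identity L).telecoreHom.app w).obj y) ≫ (identityθ L w).hom.app y)
        (((L.contactOver).μ e).hom.app y) :=
      (heq_comp (by rw [hΨ]; rfl) (by rw [hΨ]; rfl) rfl h₄ h₅).trans (heq_of_eq (Category.comp_id _))
    exact hL.trans hR.symm

/-- **the typed telecore clause of Cor 5.5 (vi) HOLDS at the identity panalocalization of EVERY setting with
`V(F_mod) ≠ ∅`** (consistency of the clause with every setting; honest label: `L₁ = L₂`).
[cite: MochizukiAbsTopIII2015, Cor 5.5 (vi) p. 132] -/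
theorem cor55PanalocalizationTelecore_identity [Nonempty Vmod] : (identity L).Cor55PanalocalizationTelecore :=
  (identity L).cor55PanalocalizationTelecore_of_overHom (identityTelecoreOverHom L)

/-- hence, at every setting over a nonempty index set, SOME panalocalization `L → L` with `panT = 𝟭`, `pan = 𝟭` (the
identification clauses of the NV witness of record, abc-iut-w4-d095's `Panalocalization.exists_self_panT_eq_id`) satisfies
the typed telecore clause of Cor 5.5 (vi). [cite: MochizukiAbsTopIII2015, Cor 5.5 (vi) p. 132] -/
theorem exists_self_cor55PanalocalizationTelecore [Nonempty Vmod] :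
    ∃ P : Panalocalization L L, P.panT = 𝟭 _ ∧ P.pan = 𝟭 _ ∧ P.Cor55PanalocalizationTelecore :=
  ⟨identity L, rfl, rfl, cor55PanalocalizationTelecore_identity L⟩

end Panalocalization

end Literature.AnabelianGeometry.AbsoluteAnabelian

end
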